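import Literature.MathematicalPhysics.QuantumFieldTheory.Balaban1983to89.Node00.Record13SepCoPH
import Literature.MathematicalPhysics.QuantumFieldTheory.Balaban1983to89.T4StabilitySocket
import Summits.QuantumFields.YangMills.Theses.BalabanUVNodes

/-!
# BalabanUVNodes ∕ N13 — THE SIGN SIDE CONDITION OF (0.1) ([Balaban1989LargeFieldII] Thm 1 + (0.1) pp. 355–356) AT NODE 00's STAGE-13 RECORD
# `Node00.datumOfRecord₁₃SepCoPH` (v1.7 `SepCoPH` tokens): `B16.SignConventions (datumOfRecord₁₃SepCoPH F N θ h).C` IS A THEOREM OF THE RECORD, and the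
# (0.1)-consequences of the pin (B) that display it — (0.1) PER RUN, «Thm 1 ∧ (0.1)-per-run», the run-uniform ∕ bare-coupling readings under their located
# extra hypotheses, the ladder's (G2)∕(G5) stability socket `T4StabilitySocket` — restated AT THE RECORD with that binder GONE; the K1⁷-level corollary
# (Track A, DAG node N13 = [B16]; cluster K1 — K1⁷ `StabilityBAtRecordR13SepCoPH` = stmt-QuantumFields-20542, helper; seat `pub-ymgap-dag-n13-w3` g0,
# W-SEAT-START-LIST §n13 item 3 «the (0.1) side condition of [B16] Thm 1 p.355 at the record's tokens»; 2026-08-27; count-neutral, NOT a discharge;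
# v1.1 = v1.0 p584410 + §5 «the socket's site budget at the record», APPEND-ONLY: §1–§4 byte-identical)

HONEST FRAMING.  Count-neutral kernel BOOKKEEPING BY NAME.  The ONE hypothesis besides the pin (B) = `B16.EndStatementBPrinted` that every typed reading of
(0.1) (`B16.uvBound01PerRun_of_endStatementBPrinted`, `B16.thm1_and_perRun_of_endStatementBPrinted`, `B16.endStatementB_of_printed_bounded`,
`B16.uvBound01PerBare_of_cor3_floor`) and every theorem of the ladder's stability socket (`T4StabilitySocket.smallFieldMass_nonneg ∕ exp_neg_mul_smallFieldMass_le_integral_dens ∕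
dressed_lower ∕ lowEnvelope_of_cor3With ∕ lowEnvelope_of_endStatementBPrinted ∕ globalDom_of_cor3With`) displays is the SIGN CONVENTION `χ_k ≥ 0`
(`B16.SignConventions D.C`, B16.lean :161 «implicit in print and needed for the bookkeeping»).  At NODE 00's Stage-13 record it is NOT a hypothesis: the
core's `χ_k` IS the (2.9) species `chiβOfRecord₁₃ θ = chiFixed29 θ.ν θ.ε₂₉` (node00-def-T `Node00/Record13.lean` :163, `Record13CoPH.lean` :612), a {0,1}-valued
characteristic function by seat K0e's THEOREMS `Node00.chiFix29OfRecord_mem_Icc ∕ chiFix29OfRecord_eq_zero_or_one` (`Node00/SmallFieldChi29OfRecord.lean`) — the Stage-13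
twin of node00-def's `Node00.signConventions_stage7` (`Node00/Record7.lean` :109), which the tree did not have.  §1 proves it (core-keyed `CoPH` datum, hence every
proviso edition over it; the v1.7 `SepCoPH` datum by def-T's `rfl` bridge `datumOfRecord₁₃SepCoPH_eq_coPH`; record-keyed at `IsRecordOfRecord₁₃CSepCoPH`); §2–§3 are the
cited tree theorems applied at `D := datumOfRecord₁₃SepCoPH F N θ h` with `hsign` supplied — every OTHER binder of theirs ((B) itself, the boundedness of `e±`, the
(2.6)-floor, the socket's (α)∕(γ)∕site budget∕numerator envelope) stays DISPLAYED VERBATIM; §4 reads K1⁷'s consequent through §2 (K1⁷ is a HYPOTHESIS there); §5 (v1.1)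
discharges the socket's SECOND record-determined binder, the site budget `hsites`: at the record `|T₁^{(k)}| = (2L^{m+K−k})⁴` (`Site.card_site`), so at the final scale of EVERY run
`numSites K = (2L^m)⁴` — ONE `K`-uniform number (the same count as `T4StabilityFloor.card_pbond_top` for bonds) — and the two `lowEnvelope` forms are restated with `hsign` AND `hsites` gone.
Nothing of Bałaban's is asserted; (B) is NOT proved; N13 is NOT discharged; no node is discharged; K0⁷ ∕ K1⁷ NOT closed; counts unmoved (discharged 5∕27 · Track A
5∕28).  The Yang–Mills mass gap (Clay) is NOT proved by any of this; rung R4 of the ladder (`BalabanLadder.UV`, conditional finite-𝕋⁴ bookkeeping) is the only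
thing the K-items close.  ONE finite four-torus programme at fixed `ε = L^{-K}` — nothing continuum ∕ ℝ⁴ ∕ OS ∕ mass gap.  No `sorry`, `def`, `instance`, `notation`.

Sources: [Balaban1989LargeFieldII] Thm 1 p.355, (0.1) pp.355–356 («χ_k exp[−(1∕g_k²)A(U_k) − E₋|T_η|] ≤ ρ_k ≤ exp E₊|T_η|»), p.391; [Balaban1988Convergent] Cor. 3
(2.50) p.264, (2.6) p.255, (2.17)–(2.18) p.257; [Balaban1987RG1] (2.9) p.266 (the small-field characteristic function), (0.19) p.255.
-/

noncomputable section

open MeasureTheory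

namespace Summit.QuantumFields.YangMills.BalabanUVNodes.N13UV01SignAtRecord13SepCoPH

open Literature.MathematicalPhysics.QuantumFieldTheory.Balaban1983to89
open Literature.MathematicalPhysics.QuantumFieldTheory.Balaban1983to89.T4Continuum (T4Family FiniteEpsData)
open Literature.MathematicalPhysics.QuantumFieldTheory.Balaban1983to89.DagBinding
open Literature.MathematicalPhysics.QuantumFieldTheory.Balaban1983to89.Node00
open Literature.MathematicalPhysics.QuantumFieldTheory.Balaban1983to89.T4StabilitySocket (smallFieldMass LowEnvelope nlowOf constOf)

universe u

variable (F : T4Family) (N : ℕ) [NeZero N]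

/-! ## §1. The χ of the Stage-13 record is the (2.9) characteristic function: values in `{0,1} ⊆ [0,1]`; the sign convention `B16.SignConventions` at the record -/

section Sign

variable (θ : Stage13HParams F N)

/-- **THE χ OF THE CORE-KEYED STAGE-13 DATUM IS THE (2.9) SPECIES** (`rfl` through def-T's `datumOfTower` ∕ `coreOfRecord₁₃CoPH` and the abbreviation
`chiβOfRecord₁₃ θ = chiFixed29 θ.ν θ.ε₂₉`): at run `p`, step `k`, configuration `V`,
`χ_k(V) = chiFix29OfRecord F N θ.ν θ.ε₂₉ p.K k V`. [cite: Balaban1987RG1, (2.9) p.266, (0.19) p.255 (bookkeeping)] -/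
theorem chi_datumOfRecord₁₃CoPH_apply (h : θ.Provisos₁₃CoPH F N) (p : B12.RunParams) (k : ℕ) (V : GaugeField (F.P p.K) k (SU N)) :
    ((datumOfRecord₁₃CoPH F N θ h).C p).χ k V = chiFix29OfRecord F N θ.ν θ.ε₂₉ p.K k V := rfl

/-- The same at the v1.7 `SepCoPH` datum of record (def-T's bridge `datumOfRecord₁₃SepCoPH_eq_coPH` is `rfl`). [cite: Balaban1987RG1, (2.9) p.266 (bookkeeping)] -/
theorem chi_datumOfRecord₁₃SepCoPH_apply (h : θ.Provisos₁₃SepCoPH F N) (p : B12.RunParams) (k : ℕ) (V : GaugeField (F.P p.K) k (SU N)) :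
    ((datumOfRecord₁₃SepCoPH F N θ h).C p).χ k V = chiFix29OfRecord F N θ.ν θ.ε₂₉ p.K k V := rfl

/-- `χ_k(V) ∈ {0, 1}` at the core-keyed Stage-13 datum (K0e's `chiFix29OfRecord_eq_zero_or_one`): (0.1)'s `χ_k` IS a characteristic function at the record.
[cite: Balaban1989LargeFieldII, (0.1) pp.355–356; Balaban1987RG1, (2.9) p.266 (bookkeeping)] -/
theorem chi_datumOfRecord₁₃CoPH_eq_zero_or_one (h : θ.Provisos₁₃CoPH F N) (p : B12.RunParams) (k : ℕ) (V : GaugeField (F.P p.K) k (SU N)) :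
    ((datumOfRecord₁₃CoPH F N θ h).C p).χ k V = 0 ∨ ((datumOfRecord₁₃CoPH F N θ h).C p).χ k V = 1 :=
  chiFix29OfRecord_eq_zero_or_one θ.ν θ.ε₂₉ p.K k V

/-- `0 ≤ χ_k(V) ≤ 1` at the core-keyed Stage-13 datum (K0e's `chiFix29OfRecord_mem_Icc`). [cite: Balaban1987RG1, (2.9) p.266 (bookkeeping)] -/
theorem chi_datumOfRecord₁₃CoPH_mem_Icc (h : θ.Provisos₁₃CoPH F N) (p : B12.RunParams) (k : ℕ) (V : GaugeField (F.P p.K) k (SU N)) :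
    ((datumOfRecord₁₃CoPH F N θ h).C p).χ k V ∈ Set.Icc (0 : ℝ) 1 :=
  chiFix29OfRecord_mem_Icc θ.ν θ.ε₂₉ p.K k V

/-- **THE SIGN CONVENTION OF (0.1) HOLDS AT THE CORE-KEYED STAGE-13 DATUM** — `B16.SignConventions (datumOfRecord₁₃CoPH F N θ h).C` (`χ_k ≥ 0` on every run, step and
configuration), for EVERY proviso edition over the Co-class background (all of them key their datum here by `rfl`).  The Stage-13 twin of `Node00.signConventions_stage7`.
[cite: Balaban1989LargeFieldII, (0.1) pp.355–356 (χ_k a characteristic function; bookkeeping); Balaban1987RG1, (2.9) p.266] -/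
theorem signConventions_datumOfRecord₁₃CoPH (h : θ.Provisos₁₃CoPH F N) : B16.SignConventions (datumOfRecord₁₃CoPH F N θ h).C :=
  fun p k V => (chiFix29OfRecord_mem_Icc θ.ν θ.ε₂₉ p.K k V).1

/-- **THE SIGN CONVENTION OF (0.1) HOLDS AT THE v1.7 `SepCoPH` DATUM OF RECORD** — `B16.SignConventions (datumOfRecord₁₃SepCoPH F N θ h).C`: the binder `hsign` of the
(0.1) readings and of the ladder's stability socket, AT THE RECORD's TOKENS, is a theorem. [cite: Balaban1989LargeFieldII, (0.1) pp.355–356 (bookkeeping); Balaban1987RG1, (2.9) p.266] -/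
theorem signConventions_datumOfRecord₁₃SepCoPH (h : θ.Provisos₁₃SepCoPH F N) : B16.SignConventions (datumOfRecord₁₃SepCoPH F N θ h).C :=
  signConventions_datumOfRecord₁₃CoPH F N θ h.toCore

/-- `χ_k(V) ≤ 1` at the v1.7 `SepCoPH` datum of record (the upper half of K0e's `chiFix29OfRecord_mem_Icc`). [cite: Balaban1987RG1, (2.9) p.266 (bookkeeping)] -/
theorem chi_datumOfRecord₁₃SepCoPH_le_one (h : θ.Provisos₁₃SepCoPH F N) (p : B12.RunParams) (k : ℕ) (V : GaugeField (F.P p.K) k (SU N)) :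
    ((datumOfRecord₁₃SepCoPH F N θ h).C p).χ k V ≤ 1 :=
  (chiFix29OfRecord_mem_Icc θ.ν θ.ε₂₉ p.K k V).2

end Sign

/-- **RECORD-KEYED FORM**: at EVERY v1.7 `SepCoPH` record `IsRecordOfRecord₁₃CSepCoPH F N D w` the datum's construction satisfies the sign convention — the shape of the
`hsign` binder of dag-n13-a's Stage-5 socket `B16NodeKnitSocket.s_N13E_threshold_shape_of_dominated` («`∀ D, (∃ w, Rec D w) → B16.SignConventions D.C`»), read at Stage 13.
[cite: Balaban1989LargeFieldII, (0.1) pp.355–356 (bookkeeping)] -/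
theorem signConventions_of_isRecordOfRecord₁₃CSepCoPH (D : FiniteEpsData F (SU N)) (hD : ∃ w, IsRecordOfRecord₁₃CSepCoPH F N D w) :
    B16.SignConventions D.C := by
  obtain ⟨w, θ, h, -, rfl, -⟩ := hD
  exact signConventions_datumOfRecord₁₃SepCoPH F N θ h

/-! ## §2. (0.1) read from the pin (B) AT THE RECORD — the per-run reading with NO side condition left; the run-uniform and bare-coupling readings under their located extra
hypotheses only -/

section Readings

variable (θ : Stage13HParams F N) (h : θ.Provisos₁₃SepCoPH F N)

/-- **[III] Cor. 3 ⇒ (0.1) PER RUN AT THE RECORD, unconditionally in the sign**: `B16.Cor3_250 C → B16.UVBound01PerRun C` at `C := (datumOfRecord₁₃SepCoPH F N θ h).C`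
(`B16.uvBound01PerRun_of_cor3` with `hsign` := §1). [cite: Balaban1989LargeFieldII, (0.1) p.356; Balaban1988Convergent, Cor. 3 (2.50) p.264 (bookkeeping)] -/
theorem uvBound01PerRun_datumOfRecord₁₃SepCoPH_of_cor3 (hcor : B16.Cor3_250 (datumOfRecord₁₃SepCoPH F N θ h).C) :
    B16.UVBound01PerRun (datumOfRecord₁₃SepCoPH F N θ h).C :=
  B16.uvBound01PerRun_of_cor3 (datumOfRecord₁₃SepCoPH F N θ h).C (signConventions_datumOfRecord₁₃SepCoPH F N θ h) hcor

/-- **THE PIN (B) ⇒ (0.1) PER RUN AT THE RECORD**: `B16.EndStatementBPrinted C → B16.UVBound01PerRun C` at `C := (datumOfRecord₁₃SepCoPH F N θ h).C` — p. 355's «As an immediate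
consequence of this theorem, we get … (0.1)» in its per-run reading, with the sign side condition discharged by the record. [cite: Balaban1989LargeFieldII, Thm 1 p.355, (0.1) pp.355–356 (bookkeeping)] -/
theorem uvBound01PerRun_datumOfRecord₁₃SepCoPH_of_endStatementBPrinted (hB : B16.EndStatementBPrinted (datumOfRecord₁₃SepCoPH F N θ h).C) :
    B16.UVBound01PerRun (datumOfRecord₁₃SepCoPH F N θ h).C :=
  B16.uvBound01PerRun_of_endStatementBPrinted (datumOfRecord₁₃SepCoPH F N θ h).C (signConventions_datumOfRecord₁₃SepCoPH F N θ h) hB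

/-- **p. 355's DISPLAYED PAIR «Theorem 1 + (0.1)» AT THE RECORD from the pin alone**: `EndStatementBPrinted C → Thm1Printed C ∧ UVBound01PerRun C` at
`C := (datumOfRecord₁₃SepCoPH F N θ h).C` (`B16.thm1_and_perRun_of_endStatementBPrinted`, `hsign` := §1). [cite: Balaban1989LargeFieldII, Thm 1 p.355, (0.1) pp.355–356 (bookkeeping)] -/
theorem thm1_and_perRun_datumOfRecord₁₃SepCoPH_of_endStatementBPrinted (hB : B16.EndStatementBPrinted (datumOfRecord₁₃SepCoPH F N θ h).C) :
    B16.Thm1Printed (datumOfRecord₁₃SepCoPH F N θ h).C ∧ B16.UVBound01PerRun (datumOfRecord₁₃SepCoPH F N θ h).C :=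
  B16.thm1_and_perRun_of_endStatementBPrinted (datumOfRecord₁₃SepCoPH F N θ h).C (signConventions_datumOfRecord₁₃SepCoPH F N θ h) hB

/-- THE RUN-UNIFORM READING AT THE RECORD under its located extra hypothesis ONLY: the pin + boundedness above of the dependence functions of every [III] Cor. 3 witness on
`]0, γ]` (`hbdd`, DISPLAYED — undischargeable for `e₊` under the cell's normalisation count, `B16B10Shape.ep_unbounded_of_cor3`) give `B16.EndStatementB` (`B16.endStatementB_of_printed_bounded`,
`hsign` := §1).  Recorded for completeness of the reading lattice; NOT a claim that `hbdd` holds at the record. [cite: Balaban1989LargeFieldII, (0.1) p.356 (bookkeeping)] -/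
theorem endStatementB_datumOfRecord₁₃SepCoPH_of_printed_bounded (hB : B16.EndStatementBPrinted (datumOfRecord₁₃SepCoPH F N θ h).C)
    (hbdd : ∀ γ : ℝ, 0 < γ → ∀ em ep : ℝ → ℝ, B16.Cor3With (datumOfRecord₁₃SepCoPH F N θ h).C γ em ep →
      (∃ Em : ℝ, ∀ x, 0 < x → x ≤ γ → em x ≤ Em) ∧ (∃ Ep : ℝ, ∀ x, 0 < x → x ≤ γ → ep x ≤ Ep)) :
    B16.EndStatementB (datumOfRecord₁₃SepCoPH F N θ h).C :=
  B16.endStatementB_of_printed_bounded (datumOfRecord₁₃SepCoPH F N θ h).C (signConventions_datumOfRecord₁₃SepCoPH F N θ h) hB hbdd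

/-- THE BARE-COUPLING READING AT THE RECORD under its two located extra hypotheses ONLY: [III] Cor. 3 at `γ` with `e±` bounded above on every window `[g_min, γ]` (`hbdd`) and
the (2.6)-floor `g_0 ≤ (1+β₀) g_k` along the runs of the `]0, γ]`-family (`hfloor` — [Balaban1988Convergent] p. 255, UNPROVED in print, DISPLAYED) give `B16.UVBound01PerBare`
(`B16.uvBound01PerBare_of_cor3_floor`, `hsign` := §1). [cite: Balaban1989LargeFieldII, (0.1) p.356; Balaban1988Convergent, (2.6) p.255 (bookkeeping)] -/
theorem uvBound01PerBare_datumOfRecord₁₃SepCoPH_of_cor3_floor (γ : ℝ) (hγ : 0 < γ) (em ep : ℝ → ℝ)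
    (hcor : B16.Cor3With (datumOfRecord₁₃SepCoPH F N θ h).C γ em ep)
    (hbdd : ∀ gmin : ℝ, 0 < gmin → gmin ≤ γ →
      (∃ Em : ℝ, ∀ x, gmin ≤ x → x ≤ γ → em x ≤ Em) ∧ (∃ Ep : ℝ, ∀ x, gmin ≤ x → x ≤ γ → ep x ≤ Ep))
    (β₀ : ℝ) (hβ₀ : 0 ≤ β₀)
    (hfloor : ∀ P : B12.RunParams, ((datumOfRecord₁₃SepCoPH F N θ h).C P).flow.InInterval γ P.K →
      ∀ k, k ≤ P.K → ((datumOfRecord₁₃SepCoPH F N θ h).C P).flow.g 0 ≤ (1 + β₀) * ((datumOfRecord₁₃SepCoPH F N θ h).C P).flow.g k) :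
    B16.UVBound01PerBare (datumOfRecord₁₃SepCoPH F N θ h).C :=
  B16.uvBound01PerBare_of_cor3_floor (datumOfRecord₁₃SepCoPH F N θ h).C (signConventions_datumOfRecord₁₃SepCoPH F N θ h) γ hγ em ep hcor hbdd β₀ hβ₀ hfloor

/-- MONOTONICITY OF (0.1) IN ITS EXPONENTS AT THE RECORD with the sign gone: enlarging `E₋, E₊` preserves `B16.UVIneq` at every run, step and configuration of the datum of record
(`B16.uvIneq_of_le` with `hχ` := §1) — the form module 36's `…_dominated` knits use. [cite: Balaban1989LargeFieldII, (0.1) pp.355–356 (bookkeeping)] -/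
theorem uvIneq_datumOfRecord₁₃SepCoPH_of_le (P : B12.RunParams) (k : ℕ) (V : GaugeField (F.P P.K) k (SU N)) {Em Ep Em' Ep' : ℝ}
    (hUV : B16.UVIneq ((datumOfRecord₁₃SepCoPH F N θ h).C P) k V Em Ep) (hm : Em ≤ Em') (hp : Ep ≤ Ep') :
    B16.UVIneq ((datumOfRecord₁₃SepCoPH F N θ h).C P) k V Em' Ep' :=
  B16.uvIneq_of_le ((datumOfRecord₁₃SepCoPH F N θ h).C P) k V (signConventions_datumOfRecord₁₃SepCoPH F N θ h P k V) hUV hm hp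

end Readings

/-! ## §3. The ladder's (G2)∕(G5) STABILITY SOCKET `T4StabilitySocket` AT THE RECORD — `hsign` gone, every other binder displayed verbatim -/

section Socket

variable (θ : Stage13HParams F N) (h : θ.Provisos₁₃SepCoPH F N)

/-- The socket's small-field Wilson mass of the last step is `≥ 0` at the record (`T4StabilitySocket.smallFieldMass_nonneg`, `hsign` := §1). [cite: Balaban1988Convergent, Cor. 3 (2.50) p.264 (bookkeeping)] -/
theorem smallFieldMass_nonneg_datumOfRecord₁₃SepCoPH (K : ℕ) (g₀ : ℝ) : 0 ≤ smallFieldMass (datumOfRecord₁₃SepCoPH F N θ h) K g₀ :=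
  T4StabilitySocket.smallFieldMass_nonneg (datumOfRecord₁₃SepCoPH F N θ h) (signConventions_datumOfRecord₁₃SepCoPH F N θ h) K g₀

/-- **(2.50)-LOWER AT THE FINAL SCALE, INTEGRATED, AT THE RECORD** (`T4StabilitySocket.exp_neg_mul_smallFieldMass_le_integral_dens`, `hsign` := §1): from the `Cor3_250`
conjunct unpacked (`hcor`, DISPLAYED) and the run's interval hypothesis, `exp[−e₋(g_K)·|T₁^{(K)}|] · c_low(K) ≤ ∫ ρ_K dV_K`. [cite: Balaban1988Convergent, Cor. 3 (2.50) p.264 (bookkeeping)] -/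
theorem exp_neg_mul_smallFieldMass_le_integral_dens_datumOfRecord₁₃SepCoPH {γB : ℝ} {em ep : ℝ → ℝ}
    (hcor : B16.Cor3With (datumOfRecord₁₃SepCoPH F N θ h).C γB em ep) (K : ℕ) (g₀ : ℝ)
    (hI : ((datumOfRecord₁₃SepCoPH F N θ h).C ⟨K, F.m, g₀⟩).flow.InInterval γB K) :
    Real.exp (-(em (((datumOfRecord₁₃SepCoPH F N θ h).C ⟨K, F.m, g₀⟩).flow.g K) * (((datumOfRecord₁₃SepCoPH F N θ h).C ⟨K, F.m, g₀⟩).numSites K : ℝ))) *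
        smallFieldMass (datumOfRecord₁₃SepCoPH F N θ h) K g₀ ≤
      ∫ V, (datumOfRecord₁₃SepCoPH F N θ h).dens K g₀ K V ∂fieldMeasure (F.P K) K (SU N) :=
  T4StabilitySocket.exp_neg_mul_smallFieldMass_le_integral_dens (datumOfRecord₁₃SepCoPH F N θ h) (signConventions_datumOfRecord₁₃SepCoPH F N θ h) hcor K g₀ hI

/-- **THE (G2) CHAIN OF ONE RUN AT THE RECORD** (`T4StabilitySocket.dressed_lower`, `hsign` := §1): (2.50)-lower at `k = K` integrated, (0.4) + push-forward, the bounded source: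
`e^{−|t|B} · (e^{−e₋(g_K)|T₁^{(K)}|} · c_low(K)) ≤ ∫ e^{tF(U)} ρ₀(U) dU`. [cite: Balaban1988Convergent, Cor. 3 (2.50) p.264; Balaban1989LargeFieldI, (0.4) p.176 (bookkeeping)] -/
theorem dressed_lower_datumOfRecord₁₃SepCoPH {γB : ℝ} {em ep : ℝ → ℝ}
    (hcor : B16.Cor3With (datumOfRecord₁₃SepCoPH F N θ h).C γB em ep) (K : ℕ) (g₀ : ℝ)
    (hI : ((datumOfRecord₁₃SepCoPH F N θ h).C ⟨K, F.m, g₀⟩).flow.InInterval γB K)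
    {obs : GaugeField (F.P K) 0 (SU N) → ℝ} {B : ℝ} (hobs : Measurable obs) (hbd : ∀ U, |obs U| ≤ B) (t : ℝ) :
    Real.exp (-(|t| * B)) *
        (Real.exp (-(em (((datumOfRecord₁₃SepCoPH F N θ h).C ⟨K, F.m, g₀⟩).flow.g K) * (((datumOfRecord₁₃SepCoPH F N θ h).C ⟨K, F.m, g₀⟩).numSites K : ℝ))) *
          smallFieldMass (datumOfRecord₁₃SepCoPH F N θ h) K g₀) ≤
      ∫ U, Real.exp (t * obs U) * (datumOfRecord₁₃SepCoPH F N θ h).dens K g₀ 0 U ∂fieldMeasure (F.P K) 0 (SU N) :=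
  T4StabilitySocket.dressed_lower (datumOfRecord₁₃SepCoPH F N θ h) (signConventions_datumOfRecord₁₃SepCoPH F N θ h) hcor K g₀ hI hobs hbd t

/-- **THE (G2)∕(G5) SOCKET, `Cor3With` FORM, AT THE RECORD** (`T4StabilitySocket.lowEnvelope_of_cor3With`, `hsign` := §1): binders VERBATIM — `hcor` (the `Cor3_250` conjunct
unpacked), tuning `htuned`, the run-index map `κ`, a measurable bounded observable family, (α) `hα`, (γ) `hfloor`, the site budget `hsites`, the numerator envelope `hnup`.
Conclusion: `LowEnvelope l₀ T A (nlowOf l₀ B e₋⁺ n₁ c₀) nup (constOf l₀ B e₋⁺ n₁ c₀ Nup) K₀`, `e₋⁺ = max (e₋ g) 0`. [cite: Balaban1988Convergent, Cor. 3 (2.50) p.264 (bookkeeping)] -/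
theorem lowEnvelope_datumOfRecord₁₃SepCoPH_of_cor3With
    {γB γ g : ℝ} {em ep : ℝ → ℝ} {g₀ : ℕ → ℝ} (hcor : B16.Cor3With (datumOfRecord₁₃SepCoPH F N θ h).C γB em ep) (hγ : γ ≤ γB)
    (htuned : (datumOfRecord₁₃SepCoPH F N θ h).Tuned γ g g₀) (κ : ℕ → ℕ)
    {obs : (K : ℕ) → GaugeField (F.P K) 0 (SU N) → ℝ} {B l₀ : ℝ}
    (hobs : ∀ K, Measurable (obs K)) (hbd : ∀ K U, |obs K U| ≤ B)
    {ι : Type*} {T : ℕ → Finset ι} {A : ℕ → ℝ → ι → ℝ} {K₀ : ℕ}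
    (hα : ∀ K t, |t| ≤ l₀ → K₀ ≤ K →
      ∫ U, Real.exp (t * obs (κ K) U) * (datumOfRecord₁₃SepCoPH F N θ h).dens (κ K) (g₀ (κ K)) 0 U ∂fieldMeasure (F.P (κ K)) 0 (SU N) ≤
        ∑ τ ∈ T K, A K t τ)
    {c₀ n₁ : ℝ} (hc₀ : 0 < c₀) (hfloor : ∀ K, K₀ ≤ K → c₀ ≤ smallFieldMass (datumOfRecord₁₃SepCoPH F N θ h) (κ K) (g₀ (κ K)))
    (hsites : ∀ K, K₀ ≤ K → (((datumOfRecord₁₃SepCoPH F N θ h).C ⟨κ K, F.m, g₀ (κ K)⟩).numSites (κ K) : ℝ) ≤ n₁)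
    {nup : ℕ → ℝ → ℝ} {Nup : ℝ} (hnup : ∀ K t, |t| ≤ l₀ → K₀ ≤ K → 0 ≤ nup K t ∧ nup K t ≤ Nup) :
    LowEnvelope l₀ T A (nlowOf l₀ B (max (em g) 0) n₁ c₀) nup (constOf l₀ B (max (em g) 0) n₁ c₀ Nup) K₀ :=
  T4StabilitySocket.lowEnvelope_of_cor3With (datumOfRecord₁₃SepCoPH F N θ h) (signConventions_datumOfRecord₁₃SepCoPH F N θ h) hcor hγ htuned κ hobs hbd hα hc₀ hfloor hsites hnup

/-- **THE (G2)∕(G5) SOCKET FROM THE PIN, AT THE RECORD** (`T4StabilitySocket.lowEnvelope_of_endStatementBPrinted`, `hsign` := §1): from `(hB : B16.EndStatementBPrinted D.C)` at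
`D := datumOfRecord₁₃SepCoPH F N θ h` — the (B) conjunct K1⁷ asks for AT THIS DATUM — the socket's conclusion in the quantifier order of the cell's conditional targets; every
binder other than `hsign` as in the source. [cite: Balaban1989LargeFieldII, Thm 1 p.355, (0.1) pp.355–356; Balaban1988Convergent, Cor. 3 (2.50) p.264 (bookkeeping)] -/
theorem lowEnvelope_datumOfRecord₁₃SepCoPH_of_endStatementBPrinted (hB : B16.EndStatementBPrinted (datumOfRecord₁₃SepCoPH F N θ h).C)
    (obs : (K : ℕ) → GaugeField (F.P K) 0 (SU N) → ℝ) (B l₀ : ℝ)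
    (hobs : ∀ K, Measurable (obs K)) (hbd : ∀ K U, |obs K U| ≤ B) :
    ∃ γ₀ : ℝ, 0 < γ₀ ∧ ∀ γ g : ℝ, γ ≤ γ₀ → ∃ Em : ℝ, 0 ≤ Em ∧
      ∀ (g₀ : ℕ → ℝ), (datumOfRecord₁₃SepCoPH F N θ h).Tuned γ g g₀ → ∀ (κ : ℕ → ℕ) {ι : Type u} (T : ℕ → Finset ι) (A : ℕ → ℝ → ι → ℝ) (K₀ : ℕ),
        (∀ K t, |t| ≤ l₀ → K₀ ≤ K →
          ∫ U, Real.exp (t * obs (κ K) U) * (datumOfRecord₁₃SepCoPH F N θ h).dens (κ K) (g₀ (κ K)) 0 U ∂fieldMeasure (F.P (κ K)) 0 (SU N) ≤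
            ∑ τ ∈ T K, A K t τ) →
        ∀ (c₀ n₁ : ℝ), 0 < c₀ → (∀ K, K₀ ≤ K → c₀ ≤ smallFieldMass (datumOfRecord₁₃SepCoPH F N θ h) (κ K) (g₀ (κ K))) →
          (∀ K, K₀ ≤ K → (((datumOfRecord₁₃SepCoPH F N θ h).C ⟨κ K, F.m, g₀ (κ K)⟩).numSites (κ K) : ℝ) ≤ n₁) →
        ∀ (nup : ℕ → ℝ → ℝ) (Nup : ℝ), (∀ K t, |t| ≤ l₀ → K₀ ≤ K → 0 ≤ nup K t ∧ nup K t ≤ Nup) →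
          LowEnvelope l₀ T A (nlowOf l₀ B Em n₁ c₀) nup (constOf l₀ B Em n₁ c₀ Nup) K₀ :=
  T4StabilitySocket.lowEnvelope_of_endStatementBPrinted (datumOfRecord₁₃SepCoPH F N θ h) (signConventions_datumOfRecord₁₃SepCoPH F N θ h) hB obs B l₀ hobs hbd

end Socket

/-! ## §4. At the crux: what item K1⁷ `StabilityBAtRecordR13SepCoPH` (a HYPOTHESIS here) yields for p. 355's pair «Thm 1 + (0.1)» at the record, non-vacuously on a run
with steps -/

section Crux

open Summit.QuantumFields.YangMills.Theses.BalabanUVNodes (StabilityBAtRecordR13SepCoPH Record13SepCoPHInhabited)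

/-- **K1⁷ ⇒ «THEOREM 1 + (0.1)-PER-RUN» AT SOME GUARDED ADMISSIBLE STAGE-13 RECORD, WITH THE WINDOW** (`N := 2`): given item K1⁷ (hypothesis `h1`) and K0⁷'s
inhabitation clause at `F` (hypothesis `h0F`), the record K1⁷ produces carries `B16.Thm1Printed ∧ B16.UVBound01PerRun` — the sign side condition of the second
conjunct discharged by §1 — and K1⁷'s `K ≥ 1` window.  K1⁷ is NOT proved here. [cite: Balaban1989LargeFieldII, Thm 1 p.355, (0.1) pp.355–356, p.391 (bookkeeping)] -/
theorem thm1_and_perRun_at_record_of_stabilityBAtRecordR13SepCoPH (h1 : StabilityBAtRecordR13SepCoPH) (F : T4Family)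
    (h0F : ∃ θ : Stage13HParams F 2, θ.Provisos₁₃SepCoPH F 2 ∧ (θ.ZhUnity F 2 ∧ θ.SlotsNondegenerate₁₃ F 2) ∧ θ.Admissible F 2) :
    ∃ (θ : Stage13HParams F 2) (h : θ.Provisos₁₃SepCoPH F 2), (θ.ZhUnity F 2 ∧ θ.SlotsNondegenerate₁₃ F 2) ∧ θ.Admissible F 2 ∧
      B16.Thm1Printed (datumOfRecord₁₃SepCoPH F 2 θ h).C ∧ B16.UVBound01PerRun (datumOfRecord₁₃SepCoPH F 2 θ h).C ∧
      ∃ γ₁ : ℝ, 0 < γ₁ ∧ ∀ γ : ℝ, 0 < γ → γ ≤ γ₁ →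
        ∃ P : B12.RunParams, 1 ≤ P.K ∧ ((datumOfRecord₁₃SepCoPH F 2 θ h).C P).flow.InInterval γ P.K := by
  obtain ⟨θ, h, hU, hθ, hB, hwin⟩ := h1 F h0F
  exact ⟨θ, h, hU, hθ, (thm1_and_perRun_datumOfRecord₁₃SepCoPH_of_endStatementBPrinted F 2 θ h hB).1,
    (thm1_and_perRun_datumOfRecord₁₃SepCoPH_of_endStatementBPrinted F 2 θ h hB).2, hwin⟩

/-- **K0⁷ ∧ K1⁷ ⇒ (0.1) HOLDS NON-VACUOUSLY AT THE RECORD** (`N := 2`): on EVERY four-torus family `F` there are a guarded admissible Stage-13 record and a threshold `γ₂ > 0`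
such that for every `0 < γ ≤ γ₂` SOME run `P` WITH STEPS (`1 ≤ P.K`) lies in `]0, γ]` AND carries (0.1) with ONE pair `E₋, E₊` at every step `k ≤ P.K` and every configuration
— the per-run reading's ∃-clause MEETS the window's run (thresholds merged by `min`, interval monotonicity `B14Cor3.inInterval_of_le`).  K0⁷, K1⁷ are HYPOTHESES.
[cite: Balaban1989LargeFieldII, (0.1) pp.355–356 (bookkeeping)] -/
theorem exists_windowed_run_uvIneq_of_record13SepCoPHInhabited_of_stabilityBAtRecordR13SepCoPH (h0 : Record13SepCoPHInhabited)
    (h1 : StabilityBAtRecordR13SepCoPH) (F : T4Family) :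
    ∃ (θ : Stage13HParams F 2) (h : θ.Provisos₁₃SepCoPH F 2), (θ.ZhUnity F 2 ∧ θ.SlotsNondegenerate₁₃ F 2) ∧ θ.Admissible F 2 ∧
      ∃ γ₂ : ℝ, 0 < γ₂ ∧ ∀ γ : ℝ, 0 < γ → γ ≤ γ₂ →
        ∃ P : B12.RunParams, 1 ≤ P.K ∧ ((datumOfRecord₁₃SepCoPH F 2 θ h).C P).flow.InInterval γ P.K ∧
          ∃ Em Ep : ℝ, ∀ k, k ≤ P.K → ∀ V : ((datumOfRecord₁₃SepCoPH F 2 θ h).C P).Cfg k,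
            B16.UVIneq ((datumOfRecord₁₃SepCoPH F 2 θ h).C P) k V Em Ep := by
  obtain ⟨θ, h, hU, hθ, -, h01, γ₁, hγ₁, hwin⟩ := thm1_and_perRun_at_record_of_stabilityBAtRecordR13SepCoPH h1 F (h0 F)
  obtain ⟨γ₀, hγ₀, hrun⟩ := h01
  refine ⟨θ, h, hU, hθ, min γ₀ γ₁, lt_min hγ₀ hγ₁, fun γ hγ hγle => ?_⟩
  obtain ⟨P, hK, hI⟩ := hwin γ hγ (hγle.trans (min_le_right _ _))
  exact ⟨P, hK, hI, hrun P (B14Cor3.inInterval_of_le hI (hγle.trans (min_le_left _ _)))⟩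

end Crux

/-! ## §5 (v1.1). The socket's SITE BUDGET at the record: `|T₁^{(k)}| = (2L^{m+K−k})⁴`, at the final scale `(2L^m)⁴` for EVERY run — `hsites` gone as well -/

section SiteBudget

variable (θ : Stage13HParams F N) (h : θ.Provisos₁₃SepCoPH F N)

/-- **THE SITE COUNT OF THE DATUM OF RECORD** (`numSites k = |Site (F.P p.K) k|` by def-T's `datumOfTower`, `Site.card_site`, `Params.sitesPerDir`): at run `p`, step `k`,
`|T₁^{(k)}| = (2·L^{m+K−k})⁴`. [cite: Balaban1987RG1, (0.1) p.251 (bookkeeping: the torus count)] -/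
theorem numSites_datumOfRecord₁₃SepCoPH (p : B12.RunParams) (k : ℕ) :
    ((datumOfRecord₁₃SepCoPH F N θ h).C p).numSites k = (2 * F.L ^ (F.m + p.K - k)) ^ 4 := by
  show Fintype.card (Site (F.P p.K) k) = _
  rw [Site.card_site]
  rfl

/-- **AT THE FINAL SCALE THE SITE COUNT IS ONE `K`-UNIFORM NUMBER**: for the run `⟨K, m, g₀⟩`, `|T₁^{(K)}| = (2·L^m)⁴` — the unit lattice of the fixed torus, whatever `K`
(companion of `T4StabilityFloor.card_pbond_top` for bonds). [cite: Balaban1987RG1, (0.1) p.251 (bookkeeping)] -/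
theorem numSites_datumOfRecord₁₃SepCoPH_top (K : ℕ) (g₀ : ℝ) :
    ((datumOfRecord₁₃SepCoPH F N θ h).C ⟨K, F.m, g₀⟩).numSites K = (2 * F.L ^ F.m) ^ 4 := by
  rw [numSites_datumOfRecord₁₃SepCoPH]
  simp

/-- The socket's site-budget binder `hsites` HOLDS at the record with `n₁ := (2·L^m)⁴`, for every run-index map `κ`, every bare-coupling family and every `K` (no threshold needed).
[cite: Balaban1988Convergent, Cor. 3 (2.50) p.264 (bookkeeping: the volume factor `|T_η|` at the unit scale)] -/
theorem numSites_datumOfRecord₁₃SepCoPH_top_le (κ : ℕ → ℕ) (g₀ : ℕ → ℝ) (K : ℕ) :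
    (((datumOfRecord₁₃SepCoPH F N θ h).C ⟨κ K, F.m, g₀ (κ K)⟩).numSites (κ K) : ℝ) ≤ (2 * (F.L : ℝ) ^ F.m) ^ 4 := by
  rw [numSites_datumOfRecord₁₃SepCoPH_top]
  push_cast
  exact le_rfl

/-- **THE (G2)∕(G5) SOCKET, `Cor3With` FORM, AT THE RECORD WITH `hsign` AND `hsites` GONE** (§3 `lowEnvelope_datumOfRecord₁₃SepCoPH_of_cor3With` at `n₁ := (2·L^m)⁴`): the binders left are
exactly the external ones — `hcor` (the `Cor3_250` conjunct unpacked), tuning, the observable family, (α) `hα`, (γ) `hfloor`, the numerator envelope `hnup`.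
[cite: Balaban1988Convergent, Cor. 3 (2.50) p.264 (bookkeeping)] -/
theorem lowEnvelope_datumOfRecord₁₃SepCoPH_of_cor3With_unitVolume
    {γB γ g : ℝ} {em ep : ℝ → ℝ} {g₀ : ℕ → ℝ} (hcor : B16.Cor3With (datumOfRecord₁₃SepCoPH F N θ h).C γB em ep) (hγ : γ ≤ γB)
    (htuned : (datumOfRecord₁₃SepCoPH F N θ h).Tuned γ g g₀) (κ : ℕ → ℕ)
    {obs : (K : ℕ) → GaugeField (F.P K) 0 (SU N) → ℝ} {B l₀ : ℝ}
    (hobs : ∀ K, Measurable (obs K)) (hbd : ∀ K U, |obs K U| ≤ B)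
    {ι : Type*} {T : ℕ → Finset ι} {A : ℕ → ℝ → ι → ℝ} {K₀ : ℕ}
    (hα : ∀ K t, |t| ≤ l₀ → K₀ ≤ K →
      ∫ U, Real.exp (t * obs (κ K) U) * (datumOfRecord₁₃SepCoPH F N θ h).dens (κ K) (g₀ (κ K)) 0 U ∂fieldMeasure (F.P (κ K)) 0 (SU N) ≤
        ∑ τ ∈ T K, A K t τ)
    {c₀ : ℝ} (hc₀ : 0 < c₀) (hfloor : ∀ K, K₀ ≤ K → c₀ ≤ smallFieldMass (datumOfRecord₁₃SepCoPH F N θ h) (κ K) (g₀ (κ K)))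
    {nup : ℕ → ℝ → ℝ} {Nup : ℝ} (hnup : ∀ K t, |t| ≤ l₀ → K₀ ≤ K → 0 ≤ nup K t ∧ nup K t ≤ Nup) :
    LowEnvelope l₀ T A (nlowOf l₀ B (max (em g) 0) ((2 * (F.L : ℝ) ^ F.m) ^ 4) c₀) nup
      (constOf l₀ B (max (em g) 0) ((2 * (F.L : ℝ) ^ F.m) ^ 4) c₀ Nup) K₀ :=
  lowEnvelope_datumOfRecord₁₃SepCoPH_of_cor3With F N θ h hcor hγ htuned κ hobs hbd hα hc₀ hfloor
    (fun K _ => numSites_datumOfRecord₁₃SepCoPH_top_le F N θ h κ g₀ K) hnup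

/-- **THE (G2)∕(G5) SOCKET FROM THE PIN, AT THE RECORD, WITH `hsign` AND `hsites` GONE** (§3 `lowEnvelope_datumOfRecord₁₃SepCoPH_of_endStatementBPrinted`'s chain at `n₁ := (2·L^m)⁴`): from
`(hB : B16.EndStatementBPrinted D.C)` at `D := datumOfRecord₁₃SepCoPH F N θ h` — the (B) conjunct of K1⁷ AT THIS DATUM — the socket's conclusion with the volume factor the record's own
`(2·L^m)⁴`; the site-budget ∀-clause of the v1.0 form is no longer asked. [cite: Balaban1989LargeFieldII, Thm 1 p.355, (0.1) pp.355–356; Balaban1988Convergent, Cor. 3 (2.50) p.264 (bookkeeping)] -/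
theorem lowEnvelope_datumOfRecord₁₃SepCoPH_of_endStatementBPrinted_unitVolume (hB : B16.EndStatementBPrinted (datumOfRecord₁₃SepCoPH F N θ h).C)
    (obs : (K : ℕ) → GaugeField (F.P K) 0 (SU N) → ℝ) (B l₀ : ℝ)
    (hobs : ∀ K, Measurable (obs K)) (hbd : ∀ K U, |obs K U| ≤ B) :
    ∃ γ₀ : ℝ, 0 < γ₀ ∧ ∀ γ g : ℝ, γ ≤ γ₀ → ∃ Em : ℝ, 0 ≤ Em ∧
      ∀ (g₀ : ℕ → ℝ), (datumOfRecord₁₃SepCoPH F N θ h).Tuned γ g g₀ → ∀ (κ : ℕ → ℕ) {ι : Type u} (T : ℕ → Finset ι) (A : ℕ → ℝ → ι → ℝ) (K₀ : ℕ),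
        (∀ K t, |t| ≤ l₀ → K₀ ≤ K →
          ∫ U, Real.exp (t * obs (κ K) U) * (datumOfRecord₁₃SepCoPH F N θ h).dens (κ K) (g₀ (κ K)) 0 U ∂fieldMeasure (F.P (κ K)) 0 (SU N) ≤
            ∑ τ ∈ T K, A K t τ) →
        ∀ (c₀ : ℝ), 0 < c₀ → (∀ K, K₀ ≤ K → c₀ ≤ smallFieldMass (datumOfRecord₁₃SepCoPH F N θ h) (κ K) (g₀ (κ K))) →
        ∀ (nup : ℕ → ℝ → ℝ) (Nup : ℝ), (∀ K t, |t| ≤ l₀ → K₀ ≤ K → 0 ≤ nup K t ∧ nup K t ≤ Nup) →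
          LowEnvelope l₀ T A (nlowOf l₀ B Em ((2 * (F.L : ℝ) ^ F.m) ^ 4) c₀) nup (constOf l₀ B Em ((2 * (F.L : ℝ) ^ F.m) ^ 4) c₀ Nup) K₀ := by
  obtain ⟨γB, hγB, em, ep, hcor⟩ := hB.2
  refine ⟨γB, hγB, fun γ g hγ => ⟨max (em g) 0, le_max_right _ _, ?_⟩⟩
  intro g₀ htuned κ ι T A K₀ hα c₀ hc₀ hfloor nup Nup hnup
  exact lowEnvelope_datumOfRecord₁₃SepCoPH_of_cor3With_unitVolume F N θ h hcor hγ htuned κ hobs hbd hα hc₀ hfloor hnup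

end SiteBudget

end Summit.QuantumFields.YangMills.BalabanUVNodes.N13UV01SignAtRecord13SepCoPH

end
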